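import Summits.BirchSwinnertonDyer.Rank1Residual.P2.CongruentNumberThetaStarFamily
import HarnessLib
import HarnessLib.Audit.Tags

/-!
# Cell «bsd-monsky» (prover-B): THE STAR FAMILY, clause (b) — Monsky's even `2`-descent matrix on the star configuration has a
# `2`-element kernel for EVERY number of primes (`s(n) = 1`), hence rank `1`, `Ш(E_n)[2^∞] = 0` and `BSD(E_n, 2)` for
# `n = 2·q·p₁⋯p_m` through the tree's uniform even door, relative to {`tyz_cmPointGaloisData`, TYZ Thm. 1.1, GZK, Monsky's even matrix
# theorem} (kernel theorem; nothing asserted, nothing booked)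

HONEST FRAMING (cell `bsd-monsky`, run/shared/lean/pub/bsd-monsky/; README §1/§3): the cell's CLAIMED theorem is Monsky's 1990
conjecture (a)+(b) on the `k = 2` family `𝒮⁻`; «ℓ ≥ 3 rungs are NOT claimed — record what the same argument gives there, no more».
THIS FILE completes the record UNIFORM IN THE NUMBER OF PRIME FACTORS begun in `P2/CongruentNumberThetaStarFamily.lean` (clause (a)
for the star family, every `m`). Clause (b) needs ONE more input, the `2`-Selmer count `#Sel₂(E_n) = 8`, which the tree's even door
`rankOne_sha_bsdp_two_iff_congruentNumberCurve_two_mul_prod` (`P2/CongruentNumberPairsAtTwoEvenThreePrimesDoor.lean`, uniform in `k`)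
takes in Monsky's currency `s(n) = 2k − rank M = 1` (`HeathBrown1994.monskySelmerRankEven`, `M = (Aᵀ + D₂, D₋₁; D₂, A + D₂)`), modulo
the named fact `hMe` (Monsky's even matrix theorem, appendix to Heath-Brown 1994) and GZK. §1 PROVES `s(n) = 1` on the star
configuration for EVERY `m` by `𝔽₂`-linear algebra (no `decide`): `D₂ = 1` (every prime is `≡ ±3 (mod 8)`), `D₋₁ = E₀₀` (only
`q ≡ 3 (mod 4)`), `Aᵀ = A` the row-sum matrix of the star graph (`q`–`pᵢ` entries `μᵢ = [(pᵢ/q) = −1]`, `pᵢ`–`pⱼ` entries `0`); the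
kernel of `M` on `(x; y)` is cut out by `μᵢ(xᵢ + x₀) + xᵢ = 0`, `xᵢ + μᵢ(yᵢ + y₀) + yᵢ = 0`, `Σμⱼ(x₀ + xⱼ) + x₀ + y₀ = 0`,
`x₀ + Σμⱼ(y₀ + yⱼ) + y₀ = 0`, whose solutions for at most one mark are `y₀·(1 + Σμ, μ₁, …, μ_m ; 1, 0, …, 0)` — two of them. §2 clause
(a) on the Legendre symbols and the rank-one datum `L′(E_n, 1) = 2^{2m}·L²·Ω·Reg`, `L` odd (`twoExponent (2qP) = 2(m+1) − 2`). §3 THE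
THEOREM (`rankOne_sha_bsdp_two_star_of_cmPointGaloisData`): for distinct primes `q ≡ 3 (mod 8)`, `p₁, …, p_m ≡ 5 (mod 8)` with `(pⱼ/pᵢ) = +1`
(`i ≠ j`) and `(pᵢ/q) = −1` for at most one `i`, `n = 2qp₁⋯p_m`: `ord_{s=1} L(E_n, s) = 1`, rank `E_n(ℚ) = 1`, `Ш(E_n)[2^∞] = 0` and
`BSD(E_n, 2)` — Monsky's (a)+(b) shape for EVERY number `m + 1 ≥ 1` of odd prime factors, relative to {`tyz_cmPointGaloisData`,
`thm11_parity_of_scriptL`, GZK, `monsky_card_selmerGroup_two_even`} (at `m = 1`, one mark: the cell's theorem on `𝒮⁻ ∩ {q ≡ 3 (mod 8)}`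
through route B; the `k = 2` enclosure of record is NOT touched). CONTROL (never an input): kit j252342 — `s(n) = 1` on 224/224
members (`m ≤ 5`). CONDITIONAL on the named facts said; nothing asserted; no class booked. NOT refereed; not part of PROOF-B v1.3 / the paper.

References: [HeathBrown1994SelmerCongruentII] Appendix (Monsky), typescript p. 39 L10–L26 (A, D_j), p. 41 L20–L36 (even M, s(D));
[TianYuanZhang2017] §1 (1.1), Thm. 1.1, Thm. 3.5; [SilvermanAEC2009] Thm. X.4.2; [IrelandRosen1990] Ch. 5 §1 Prop. 5.1.2–5.1.3, §2 Thm. 2;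
[Miller2011LMS] Def. 1.1; HOME/proof/PROOF-B-THETA-STAR.md (companion note).
-/

noncomputable section

open scoped Classical

open Matrix Finset WeierstrassCurve Literature.NumberTheory.EllipticCurves
  Literature.NumberTheory.EllipticCurves.Rank1Residual
  Literature.NumberTheory.EllipticCurves.Rank1Residual.Typed
  Literature.NumberTheory.EllipticCurves.HeathBrown1994
  Literature.NumberTheory.EllipticCurves.HeathBrown1994.Families
  Literature.NumberTheory.EllipticCurves.Tian2014
  Literature.NumberTheory.EllipticCurves.TianYuanZhang2017
  Literature.NumberTheory.EllipticCurves.TianYuanZhang2017.W2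
  Literature.NumberTheory.QuadraticFields.RedeiReichardt

set_option autoImplicit false

namespace Summit.BirchSwinnertonDyer.Rank1Residual.P2

namespace ThetaDescent

variable {m : ℕ} {q : ℕ} {p : Fin m → ℕ}

/-! ## §1 Monsky's even matrix on the star configuration: `#ker M = 2`, `s(n) = 1`, for every `m` -/

/-- `D₂ = 1` on the star type: `(2/q) = (2/pᵢ) = −1` (`q ≡ 3`, `pᵢ ≡ 5 (mod 8)`).
[cite: HeathBrown1994SelmerCongruentII, Appendix (Monsky), typescript p. 39 L10–L13 (D_j)] [cite: IrelandRosen1990, Ch. 5 §1 Prop. 5.1.3] -/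
theorem legendreDiagonal_two_star (hq3 : q % 8 = 3) (hp5 : ∀ i, p i % 8 = 5) :
    legendreDiagonal (vecCons q p : Fin (m + 1) → ℕ) 2 = 1 := by
  unfold legendreDiagonal
  rw [← Matrix.diagonal_one]
  congr 1; funext i; refine Fin.cases ?_ (fun j => ?_) i
  · simp only [cons_val_zero]
    exact addLegendreSym_of_eq_neg_one (jacobiSym_two_eq_neg_one (Or.inl hq3))
  · simp only [cons_val_succ]
    exact addLegendreSym_of_eq_neg_one (jacobiSym_two_eq_neg_one (Or.inr (hp5 j)))

/-- `D₋₁ = E₀₀` on the star type: `(−1/q) = −1` (`q ≡ 3 (mod 4)`), `(−1/pᵢ) = +1` (`pᵢ ≡ 1 (mod 4)`).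
[cite: HeathBrown1994SelmerCongruentII, Appendix (Monsky), typescript p. 41 L20–L26 (D₋₁)] [cite: IrelandRosen1990, Ch. 5 §1 Prop. 5.1.2] -/
theorem legendreDiagonal_neg_one_star (hq3 : q % 8 = 3) (hp5 : ∀ i, p i % 8 = 5) :
    legendreDiagonal (vecCons q p : Fin (m + 1) → ℕ) (-1) =
      Matrix.diagonal fun j : Fin (m + 1) => if j = 0 then (1 : ZMod 2) else 0 := by
  unfold legendreDiagonal
  congr 1; funext j; refine Fin.cases ?_ (fun i => ?_) j
  · rw [if_pos rfl, cons_val_zero]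
    exact addLegendreSym_of_eq_neg_one (DeuringLadic.jacobiSym_neg_one_of_mod_four (by omega))
  · rw [if_neg (Fin.succ_ne_zero i), cons_val_succ]
    exact addLegendreSym_of_eq_one (jacobiSym_neg_one_eq_one (by have := hp5 i; omega))

/-- Monsky's `A` as a row-sum matrix: `(Av)_a = Σ_b [(p_b/p_a) = −1]·(v_a + v_b)`.
[cite: HeathBrown1994SelmerCongruentII, Appendix (Monsky), typescript p. 39 L13–L26] -/
theorem legendreMatrix_mulVec_apply {k : ℕ} (P : Fin k → ℕ) (v : Fin k → ZMod 2) (a : Fin k) :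
    (legendreMatrix P *ᵥ v) a = ∑ b, addLegendreSym (P b) (P a) * (v a + v b) :=
  rowsum_mulVec_apply (fun i l => addLegendreSym (P l) (P i)) v a

/-- **The kernel of Monsky's even matrix on the star configuration, for every `m`.** With `μᵢ = [(pᵢ/q) = −1]` (at most one `μᵢ = 1`):
`M(x; y) = 0 ⟺ (x; y) ∈ {0, (1 + Σμ, μ₁, …, μ_m ; 1, 0, …, 0)}` (`D₂ = 1`, `D₋₁ = E₀₀`, `Aᵀ = A` the star graph's row-sum matrix; the
four families of scalar equations of the module docstring, solved by hand).
[cite: HeathBrown1994SelmerCongruentII, Appendix (Monsky), typescript p. 41 L20–L36 (the even matrix; evaluation ours)]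
[cite: IrelandRosen1990, Ch. 5 §2 Thm. 2 (reciprocity)] -/
theorem monskyMatrixEven_mulVec_eq_zero_iff_star (hq : q.Prime) (hq3 : q % 8 = 3) (hp : ∀ i, (p i).Prime)
    (hp5 : ∀ i, p i % 8 = 5) (hQR : ∀ i j, i ≠ j → jacobiSym (p j) (p i) = 1)
    (hμ : ∀ i j, jacobiSym (p i) q = -1 → jacobiSym (p j) q = -1 → i = j) (z : Fin (m + 1) ⊕ Fin (m + 1) → ZMod 2) :
    monskyMatrixEven (vecCons q p : Fin (m + 1) → ℕ) *ᵥ z = 0 ↔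
      z = 0 ∨ z = Sum.elim (vecCons (1 + ∑ i, addLegendreSym (p i) q) fun i => addLegendreSym (p i) q)
        (vecCons 1 fun _ => 0) := by
  -- notation and the shape of `M`
  have hodd := star_cons_odd (q := q) (p := p) hq3 hp5
  have hsymm : (legendreMatrix (vecCons q p : Fin (m + 1) → ℕ))ᵀ = legendreMatrix (vecCons q p : Fin (m + 1) → ℕ) :=
    legendreMatrix_transpose_eq _ hodd (fun i hi => by
      obtain ⟨j, rfl⟩ := Fin.exists_succ_eq.mpr hi
      simp only [cons_val_succ]; have := hp5 j; omega)
  have hD2 := legendreDiagonal_two_star (m := m) (p := p) hq3 hp5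
  have hDm1 := legendreDiagonal_neg_one_star (m := m) (p := p) hq3 hp5
  -- the entries of `A`
  set μ : Fin m → ZMod 2 := fun i => addLegendreSym (p i) q with hμdef
  have zmod_cases : ∀ c : ZMod 2, c = 0 ∨ c = 1 := by decide
  have eq_of_add : ∀ x y : ZMod 2, x + y = 0 → x = y := by decide
  have hμ1 : ∀ i j, μ i = 1 → μ j = 1 → i = j := by
    intro i j hi hj
    have hvi := jacobiSym.eq_one_or_neg_one (int_gcd_prime_eq_one (hp i) hq (fun h => by have := hp5 i; omega))
    have hvj := jacobiSym.eq_one_or_neg_one (int_gcd_prime_eq_one (hp j) hq (fun h => by have := hp5 j; omega))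
    refine hμ i j (hvi.resolve_left fun h => ?_) (hvj.resolve_left fun h => ?_)
    · simp [hμdef, addLegendreSym_of_eq_one h] at hi
    · simp [hμdef, addLegendreSym_of_eq_one h] at hj
  have hα0s : ∀ i : Fin m, addLegendreSym ((vecCons q p : Fin (m + 1) → ℕ) i.succ) ((vecCons q p : Fin (m + 1) → ℕ) 0) = μ i := by
    intro i; simp [hμdef]
  have hαs0 : ∀ i : Fin m, addLegendreSym ((vecCons q p : Fin (m + 1) → ℕ) 0) ((vecCons q p : Fin (m + 1) → ℕ) i.succ) = μ i := by
    intro i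
    simp only [cons_val_zero, cons_val_succ, hμdef]
    exact (addLegendreSym_comm_of_mod_four_eq_one (by have := hp5 i; omega) (Nat.odd_iff.mpr (by omega))).symm
  have hαss : ∀ i j : Fin m, i ≠ j →
      addLegendreSym ((vecCons q p : Fin (m + 1) → ℕ) j.succ) ((vecCons q p : Fin (m + 1) → ℕ) i.succ) = 0 := by
    intro i j hij
    simp only [cons_val_succ]
    exact addLegendreSym_of_eq_one (hQR i j hij)
  -- `(Av)_0 = Σ μᵢ (v_0 + v_i)`, `(Av)_i = μᵢ (v_i + v_0)`
  have hA0 : ∀ v : Fin (m + 1) → ZMod 2, (legendreMatrix (vecCons q p : Fin (m + 1) → ℕ) *ᵥ v) 0 =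
      ∑ i : Fin m, μ i * (v 0 + v i.succ) := by
    intro v
    rw [legendreMatrix_mulVec_apply, Fin.sum_univ_succ, CharTwo.add_self_eq_zero, mul_zero, zero_add]
    exact Finset.sum_congr rfl fun i _ => by rw [hα0s]
  have hAs : ∀ (v : Fin (m + 1) → ZMod 2) (i : Fin m), (legendreMatrix (vecCons q p : Fin (m + 1) → ℕ) *ᵥ v) i.succ =
      μ i * (v i.succ + v 0) := by
    intro v i
    rw [legendreMatrix_mulVec_apply, Fin.sum_univ_succ, hαs0]
    have hrest : ∑ j : Fin m, addLegendreSym ((vecCons q p : Fin (m + 1) → ℕ) j.succ)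
        ((vecCons q p : Fin (m + 1) → ℕ) i.succ) * (v i.succ + v j.succ) = 0 := by
      refine Finset.sum_eq_zero fun j _ => ?_
      by_cases hji : i = j
      · subst hji; rw [CharTwo.add_self_eq_zero, mul_zero]
      · rw [hαss i j hji, zero_mul]
    rw [hrest, add_zero]
  -- `M (x;y) = ((A+1)x + Ey ; x + (A+1)y)`
  have hM : ∀ x y : Fin (m + 1) → ZMod 2, monskyMatrixEven (vecCons q p : Fin (m + 1) → ℕ) *ᵥ Sum.elim x y = 0 ↔
      (∀ a, (legendreMatrix (vecCons q p : Fin (m + 1) → ℕ) *ᵥ x) a + x a + (if a = 0 then (1 : ZMod 2) else 0) * y a = 0) ∧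
      (∀ a, x a + ((legendreMatrix (vecCons q p : Fin (m + 1) → ℕ) *ᵥ y) a + y a) = 0) := by
    intro x y
    rw [monskyMatrixEven, hsymm, hD2, hDm1, Matrix.fromBlocks_mulVec]
    simp only [Sum.elim_comp_inl, Sum.elim_comp_inr, Matrix.add_mulVec, Matrix.one_mulVec]
    constructor
    · intro h
      refine ⟨fun a => ?_, fun a => ?_⟩
      · have := congr_fun h (Sum.inl a)
        simpa only [Sum.elim_inl, Pi.add_apply, Pi.zero_apply, Matrix.mulVec_diagonal] using this
      · have := congr_fun h (Sum.inr a)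
        simpa only [Sum.elim_inr, Pi.add_apply, Pi.zero_apply] using this
    · rintro ⟨ht, hb⟩
      funext c
      rcases c with a | a
      · simpa only [Sum.elim_inl, Pi.add_apply, Pi.zero_apply, Matrix.mulVec_diagonal] using ht a
      · simpa only [Sum.elim_inr, Pi.add_apply, Pi.zero_apply] using hb a
  -- the candidate kernel vector
  set w : Fin (m + 1) ⊕ Fin (m + 1) → ZMod 2 :=
    Sum.elim (vecCons (1 + ∑ i, μ i) fun i => μ i) (vecCons 1 fun _ => 0) with hw
  obtain ⟨x, y, rfl⟩ : ∃ x y, z = Sum.elim x y := ⟨z ∘ Sum.inl, z ∘ Sum.inr, (Sum.elim_comp_inl_inr z).symm⟩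
  rw [hM]
  constructor
  · rintro ⟨ht, hb⟩
    -- the scalar equations
    have ti : ∀ i : Fin m, μ i * (x i.succ + x 0) + x i.succ = 0 := by
      intro i; have h := ht i.succ; rw [hAs, if_neg (Fin.succ_ne_zero i), zero_mul, add_zero] at h; exact h
    have bi : ∀ i : Fin m, x i.succ + (μ i * (y i.succ + y 0) + y i.succ) = 0 := by
      intro i; have h := hb i.succ; rw [hAs] at h; exact h
    have t0 : ∑ j : Fin m, μ j * (x 0 + x j.succ) + x 0 + y 0 = 0 := by
      have h := ht 0; rw [hA0, if_pos rfl, one_mul] at h; exact h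
    have b0 : x 0 + (∑ j : Fin m, μ j * (y 0 + y j.succ) + y 0) = 0 := by
      have h := hb 0; rw [hA0] at h; exact h
    -- unmarked coordinates vanish
    have hxu : ∀ i, μ i = 0 → x i.succ = 0 := by
      intro i hi; have h := ti i; rw [hi, zero_mul, zero_add] at h; exact h
    have hyu : ∀ i, μ i = 0 → y i.succ = 0 := by
      intro i hi; have h := bi i; rw [hi, zero_mul, zero_add, hxu i hi, zero_add] at h; exact h
    -- solve
    have hsol : x 0 = (1 + ∑ i, μ i) * y 0 ∧ (∀ i : Fin m, x i.succ = μ i * y 0) ∧ ∀ i : Fin m, y i.succ = 0 := by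
      by_cases hex : ∃ a, μ a = 1
      · obtain ⟨a, ha⟩ := hex
        have hμ0 : ∀ j, j ≠ a → μ j = 0 := fun j hj => (zmod_cases (μ j)).resolve_right fun h => hj (hμ1 j a h ha)
        have hsum : ∑ i, μ i = 1 := by
          rw [Finset.sum_eq_single a (fun j _ hj => hμ0 j hj) (fun h => absurd (mem_univ a) h), ha]
        have hx0 : x 0 = 0 := by
          have h := ti a; rw [ha, one_mul] at h
          have : ∀ u v : ZMod 2, u + v + u = 0 → v = 0 := by decide
          exact this _ _ h
        have hxa : x a.succ = y 0 := by
          have h := bi a; rw [ha, one_mul] at h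
          have : ∀ u v s : ZMod 2, u + (v + s + v) = 0 → u = s := by decide
          exact this _ _ _ h
        have hya : y a.succ = 0 := by
          have h := b0
          rw [Finset.sum_eq_single a (fun j _ hj => by rw [hμ0 j hj, zero_mul]) (fun h => absurd (mem_univ a) h),
            ha, one_mul, hx0, zero_add] at h
          have : ∀ u v : ZMod 2, u + v + u = 0 → v = 0 := by decide
          exact this _ _ h
        have h110 : (1 + 1 : ZMod 2) = 0 := by decide
        refine ⟨by rw [hsum, hx0, h110, zero_mul], fun i => ?_, fun i => ?_⟩
        · by_cases hia : i = a
          · subst hia; rw [ha, one_mul, hxa]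
          · rw [hμ0 i hia, zero_mul]; exact hxu i (hμ0 i hia)
        · by_cases hia : i = a
          · subst hia; exact hya
          · exact hyu i (hμ0 i hia)
      · have hμ0 : ∀ j, μ j = 0 := fun j => (zmod_cases (μ j)).resolve_right fun h => hex ⟨j, h⟩
        have hsum : ∑ i, μ i = 0 := Finset.sum_eq_zero fun j _ => hμ0 j
        have hx0 : x 0 = y 0 := by
          have h := t0
          simp only [hμ0, zero_mul, Finset.sum_const_zero, zero_add] at h
          exact eq_of_add _ _ h
        refine ⟨by rw [hsum, add_zero, one_mul, hx0], fun i => ?_, fun i => hyu i (hμ0 i)⟩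
        rw [hμ0 i, zero_mul]; exact hxu i (hμ0 i)
    obtain ⟨hx0, hxs, hys⟩ := hsol
    rcases zmod_cases (y 0) with hy0 | hy0
    · left
      funext c
      rcases c with a | a <;> refine Fin.cases ?_ (fun i => ?_) a
      · simp [hx0, hy0]
      · simp [hxs i, hy0]
      · simp [hy0]
      · simp [hys i]
    · right
      funext c
      rcases c with a | a <;> refine Fin.cases ?_ (fun i => ?_) a
      · simp [hw, hx0, hy0]
      · simp [hw, hxs i, hy0]
      · simp [hw, hy0]
      · simp [hw, hys i]
  · -- both candidates lie in the kernel
    rintro (h0 | h1)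
    · have hx : x = 0 := by funext a; simpa using congr_fun h0 (Sum.inl a)
      have hy : y = 0 := by funext a; simpa using congr_fun h0 (Sum.inr a)
      subst hx; subst hy
      simp
    · have hx : x = vecCons (1 + ∑ i, μ i) fun i => μ i := by funext a; simpa [hw] using congr_fun h1 (Sum.inl a)
      have hy : y = vecCons 1 fun _ => 0 := by funext a; simpa [hw] using congr_fun h1 (Sum.inr a)
      subst hx; subst hy
      -- `Σ μᵢ²  = Σ μᵢ` in `𝔽₂`
      have hsq : ∀ c : ZMod 2, c * c = c := by decide
      have hsq' : ∀ c : ZMod 2, c * (c + (1 + c)) = c := by decide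
      constructor
      · intro a
        refine Fin.cases ?_ (fun i => ?_) a
        · rw [hA0, if_pos rfl]
          simp only [cons_val_zero, cons_val_succ, one_mul]
          have : ∑ i : Fin m, μ i * (1 + ∑ j, μ j + μ i) = (∑ j, μ j) * ∑ i, μ i := by
            rw [Finset.mul_sum]
            refine Finset.sum_congr rfl fun i _ => ?_
            have : ∀ c s : ZMod 2, c * (1 + s + c) = s * c := by decide
            exact this _ _
          rw [this]
          have : ∀ s : ZMod 2, s * s + (1 + s) + 1 = 0 := by decide
          exact this _
        · rw [hAs, if_neg (Fin.succ_ne_zero i), zero_mul, add_zero]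
          simp only [cons_val_succ, cons_val_zero]
          -- goal: `μ i * (μ i + (1 + Σ μ)) + μ i = 0`; at most one mark
          rcases zmod_cases (μ i) with hi | hi
          · rw [hi, zero_mul, zero_add]
          · have hsum : ∑ j, μ j = 1 := by
              rw [Finset.sum_eq_single i (fun j _ hj => (zmod_cases (μ j)).resolve_right fun h => hj (hμ1 j i h hi))
                (fun h => absurd (mem_univ i) h), hi]
            rw [hsum, hi]
            decide
      · intro a
        refine Fin.cases ?_ (fun i => ?_) a
        · rw [hA0]
          simp only [cons_val_zero, cons_val_succ, add_zero, mul_one]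
          have : ∀ s : ZMod 2, 1 + s + (s + 1) = 0 := by decide
          exact this _
        · rw [hAs]
          simp only [cons_val_succ, cons_val_zero, zero_add, mul_one, add_zero]
          exact CharTwo.add_self_eq_zero _

/-- **`#ker M = 2` for Monsky's EVEN matrix on the star configuration**, uniformly in `m` (`s(n) = 1` with NO per-`n` certificate).
[cite: HeathBrown1994SelmerCongruentII, Appendix (Monsky), typescript p. 41 L20–L36] -/
theorem card_ker_monskyMatrixEven_star (hq : q.Prime) (hq3 : q % 8 = 3) (hp : ∀ i, (p i).Prime) (hp5 : ∀ i, p i % 8 = 5)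
    (hQR : ∀ i j, i ≠ j → jacobiSym (p j) (p i) = 1) (hμ : ∀ i j, jacobiSym (p i) q = -1 → jacobiSym (p j) q = -1 → i = j) :
    Fintype.card {z : Fin (m + 1) ⊕ Fin (m + 1) → ZMod 2 // monskyMatrixEven (vecCons q p : Fin (m + 1) → ℕ) *ᵥ z = 0} = 2 := by
  rw [Fintype.card_of_subtype ({0, Sum.elim (vecCons (1 + ∑ i, addLegendreSym (p i) q) fun i => addLegendreSym (p i) q)
      (vecCons 1 fun _ => 0)} : Finset (Fin (m + 1) ⊕ Fin (m + 1) → ZMod 2))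
    (fun z => by
      rw [Finset.mem_insert, Finset.mem_singleton]
      exact (monskyMatrixEven_mulVec_eq_zero_iff_star hq hq3 hp hp5 hQR hμ z).symm)]
  refine Finset.card_pair fun h => ?_
  have := congr_fun h (Sum.inr 0)
  simp at this

/-- **`s(n) = 2(m+1) − rank M = 1` on the star family, for every `m`** (Monsky's even Selmer rank; with `hMe`: `#Sel₂(E_n) = 8`).
[cite: HeathBrown1994SelmerCongruentII, Appendix (Monsky), typescript p. 41 L36] -/
theorem monskySelmerRankEven_star (hq : q.Prime) (hq3 : q % 8 = 3) (hp : ∀ i, (p i).Prime) (hp5 : ∀ i, p i % 8 = 5)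
    (hQR : ∀ i j, i ≠ j → jacobiSym (p j) (p i) = 1) (hμ : ∀ i j, jacobiSym (p i) q = -1 → jacobiSym (p j) q = -1 → i = j) :
    monskySelmerRankEven (vecCons q p : Fin (m + 1) → ℕ) = 1 :=
  monskySelmerRankEven_eq_one_of_card_ker _ (card_ker_monskyMatrixEven_star hq hq3 hp hp5 hQR hμ)

/-! ## §2 Clause (a) on the Legendre symbols and the rank-one datum of the star family (`ord₂ x = 2m`) -/

/-- From the Jacobi symbols to the bits: the star hypotheses in `kroneckerBit` form. [cite: IrelandRosen1990, Ch. 5 §1 Prop. 5.1.2 (Euler's criterion)] -/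
theorem star_bits_of_jacobi (hq : q.Prime) (hq3 : q % 8 = 3) (hp : ∀ i, (p i).Prime) (hp5 : ∀ i, p i % 8 = 5)
    (hinj : Function.Injective p) (hQR : ∀ i j, i ≠ j → jacobiSym (p j) (p i) = 1)
    (hμ : ∀ i j, jacobiSym (p i) q = -1 → jacobiSym (p j) q = -1 → i = j) :
    (∀ i j, i ≠ j → kroneckerBit (p j) (p i) = 0) ∧ (∀ i j, kroneckerBit (p i) q = 1 → kroneckerBit (p j) q = 1 → i = j) := by
  have hq2 : q ≠ 2 := by omega
  have hne : ∀ i, p i ≠ q := fun i h => by have := hp5 i; omega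
  refine ⟨fun i j hij => ?_, fun i j hi hj => ?_⟩
  · exact (kroneckerBit_of_jacobiSym (hp j) (hp i) (by have := hp5 i; omega) (fun h => hij.symm (hinj h))).1 (hQR i j hij)
  · exact hμ i j ((kroneckerBit_eq_one_iff_jacobiSym hq hq2 (intCast_natCast_prime_ne_zero (hp i) hq (hne i))).mp hi)
      ((kroneckerBit_eq_one_iff_jacobiSym hq hq2 (intCast_natCast_prime_ne_zero (hp j) hq (hne j))).mp hj)

/-- **Clause (a) on the star family, stated on the Legendre symbols**, for EVERY number `m + 1 ≥ 1` of odd prime factors: for distinct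
primes `q ≡ 3 (mod 8)`, `p₁, …, p_m ≡ 5 (mod 8)` with `(pⱼ/pᵢ) = +1` (`i ≠ j`) and `(pᵢ/q) = −1` for at most one `i`:
`ord_{s=1} L(E_{2qp₁⋯p_m}, s) = 1`. Members: `30, 174, 606, …` (`m = 1`, one mark: `𝒮⁻`), `78, 110, …` (`m = 1`, no mark), `1830, 3190,
5430, …` (`m = 2`, one mark; TYZ-silent), `199470 = 2·3·5·61·109`, `577390`, … (`m = 3`), …, `417966269710 = 2·11·5·29·181·709·1021`
(`m = 5`). CONDITIONAL on {`tyz_cmPointGaloisData`, `thm11_parity_of_scriptL`} only — no GZK, no Selmer input; nothing asserted; NOT refereed.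
[cite: TianYuanZhang2017, §1 (definition of 𝓛(n), p0002 L46–L75), Thm. 1.1, §3] [cite: LiMa2008, Thm. 0.4]
[cite: IrelandRosen1990, Ch. 5 §1 Prop. 5.1.2 (Euler's criterion)] -/
theorem analyticRank_eq_one_star_family (hCM : tyz_cmPointGaloisData) (h11 : thm11_parity_of_scriptL) :
    ∀ (m q : ℕ) (p : Fin m → ℕ), q.Prime → q % 8 = 3 → (∀ i, (p i).Prime) → (∀ i, p i % 8 = 5) → Function.Injective p →
      (∀ i j, i ≠ j → jacobiSym (p j) (p i) = 1) →
      (∀ i j, jacobiSym (p i) q = -1 → jacobiSym (p j) q = -1 → i = j) →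
      (congruentNumberCurve (2 * (q * ∏ i, p i))).analyticRank = 1 := by
  intro m q p hq hq3 hp hp5 hinj hQR hμ
  obtain ⟨hQR', hμ'⟩ := star_bits_of_jacobi hq hq3 hp hp5 hinj hQR hμ
  exact analyticRank_eq_one_star_of_cmPointGaloisData hCM h11 hq hq3 hp hp5 hinj hQR' hμ'

/-- **The rank-one datum of the star family**: `ord_{s=1} L(E_n, s) = 1` and `L′(E_n, 1) = x·Ω(E_n)·Reg(E_n(ℚ))` with `x = 2^{2m}·L²`, `L` odd,
so `ord₂ x = 2(m+1) − 2` (TYZ (1.1) read in the tree: `leadingLCoeff_congruentNumberCurve_eq_of_isScriptL`, `twoExponent (2qp₁⋯p_m) = 2(m+1) − 2`).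
Relative to {`tyz_cmPointGaloisData`, GZK, TYZ Thm. 1.1}; nothing asserted. [cite: TianYuanZhang2017, §1 ((1.1), p0002 L63–L75)] -/
theorem rankOneDatum_star_of_cmPointGaloisData (hCM : tyz_cmPointGaloisData) (hGZK : rank_eq_analyticRank_of_analyticRank_le_one)
    (h11 : thm11_parity_of_scriptL) (hq : q.Prime) (hq3 : q % 8 = 3) (hp : ∀ i, (p i).Prime) (hp5 : ∀ i, p i % 8 = 5)
    (hinj : Function.Injective p) (hQR : ∀ i j, i ≠ j → jacobiSym (p j) (p i) = 1)
    (hμ : ∀ i j, jacobiSym (p i) q = -1 → jacobiSym (p j) q = -1 → i = j) :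
    (congruentNumberCurve (2 * (q * ∏ i, p i))).analyticRank = 1 ∧
    ∃ x : ℚ, x ≠ 0 ∧ padicValRat 2 x = 2 * ((m + 1 : ℕ) : ℤ) - 2 ∧
      deriv (congruentNumberCurve (2 * (q * ∏ i, p i))).entireLFunction 1 =
        (x : ℂ) * ((congruentNumberCurve (2 * (q * ∏ i, p i))).realPeriodRat : ℂ) *
          ((congruentNumberCurve (2 * (q * ∏ i, p i))).regulator : ℂ) := by
  obtain ⟨hQR', hμ'⟩ := star_bits_of_jacobi hq hq3 hp hp5 hinj hQR hμ
  have hsq := squarefree_star hq hq3 hp hp5 hinj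
  haveI := isElliptic_congruentNumberCurve hsq.ne_zero
  have hn6 := star_mod_eight hq3 hp hp5 hinj
  obtain ⟨L, hLodd, hL⟩ := exists_odd_isScriptL_star_of_cmPointGaloisData hCM hGZK h11 hq hq3 hp hp5 hinj hQR' hμ'
  have hL0' : L ≠ 0 := fun h => by simp [h] at hLodd
  have hL0 : (L : ℚ) ≠ 0 := by exact_mod_cast hL0'
  have hr1 := analyticRank_congruentNumberCurve_eq_one_of_isScriptL hsq (Or.inr (Or.inl hn6)) hL hL0'
  have he : twoExponent (2 * (q * ∏ i, p i)) = 2 * ((m + 1 : ℕ) : ℤ) - 2 := by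
    rw [← prod_star_cons]
    exact twoExponent_two_mul_prod_eq _ (star_cons_prime hq hp) (star_cons_odd hq3 hp5) (star_cons_injective hq3 hp5 hinj)
  refine ⟨hr1, (2 : ℚ) ^ twoExponent (2 * (q * ∏ i, p i)) * (L : ℚ) ^ 2,
    mul_ne_zero (zpow_ne_zero _ two_ne_zero) (pow_ne_zero _ hL0), ?_, ?_⟩
  · rw [padicValRat_two_zpow_mul_sq hLodd, he]
  · rw [← (leadingLCoeff_eq_deriv_of_analyticRank_eq_one hr1).1,
      leadingLCoeff_congruentNumberCurve_eq_of_isScriptL (Nat.pos_of_ne_zero hsq.ne_zero) hr1 hL]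
    push_cast
    ring

/-! ## §3 THE THEOREM: (a) + (b) on the star family, for every number of prime factors -/

/-- **`ord_{s=1} L = 1`, rank `1`, `Ш[2^∞] = 0` and `BSD(E_n, 2)` on the star family, for every `m`**: for distinct primes
`q ≡ 3 (mod 8)`, `p₁, …, p_m ≡ 5 (mod 8)` with `(pⱼ/pᵢ) = +1` (`i ≠ j`) and `(pᵢ/q) = −1` for at most one `i`, `n = 2qp₁⋯p_m`: the rank-one
datum (§2, `ord₂ x = 2(m+1) − 2`) and `s(n) = 1` (§1) through the uniform even door
`rankOne_sha_bsdp_two_iff_congruentNumberCurve_two_mul_prod` — Monsky's (a)+(b) shape for EVERY number `m + 1 ≥ 1` of odd prime factors.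
Members: `30 = 2·3·5`, `174`, `1830 = 2·3·5·61`, `199470 = 2·3·5·61·109`, …, `417966269710 = 2·11·5·29·181·709·1021` (`m = 5`).
Relative to {`tyz_cmPointGaloisData`, TYZ Thm. 1.1, GZK, `hMe` = Monsky's even `2`-descent matrix theorem}; NO per-`n` certificate, NO
`decide`. CONDITIONAL; nothing asserted; closes no class by itself; NOT refereed. [cite: Monsky1990MockHeegner, p. 67 Remark (3)]
[cite: TianYuanZhang2017, §1 (1.1), Thm. 3.5] [cite: HeathBrown1994SelmerCongruentII, Appendix (Monsky), typescript p. 41 L20–L36]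
[cite: SilvermanAEC2009, Thm. X.4.2] [cite: Miller2011LMS, Def. 1.1 (arXiv:1010.2431 p. 3)] -/
theorem rankOne_sha_bsdp_two_star_of_cmPointGaloisData (hCM : tyz_cmPointGaloisData)
    (hGZK : rank_eq_analyticRank_of_analyticRank_le_one) (hMe : monsky_card_selmerGroup_two_even) (h11 : thm11_parity_of_scriptL)
    (hq : q.Prime) (hq3 : q % 8 = 3) (hp : ∀ i, (p i).Prime) (hp5 : ∀ i, p i % 8 = 5) (hinj : Function.Injective p)
    (hQR : ∀ i j, i ≠ j → jacobiSym (p j) (p i) = 1) (hμ : ∀ i j, jacobiSym (p i) q = -1 → jacobiSym (p j) q = -1 → i = j) :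
    (congruentNumberCurve (2 * (q * ∏ i, p i))).analyticRank = 1 ∧
      (congruentNumberCurve (2 * (q * ∏ i, p i))).mordellWeilRank = 1 ∧
      AddCommGroup.primaryComponent (congruentNumberCurve (2 * (q * ∏ i, p i))).sha 2 = ⊥ ∧
      BSDp (congruentNumberCurve (2 * (q * ∏ i, p i))) 2 := by
  obtain ⟨-, x, hx0, hv, hx⟩ := rankOneDatum_star_of_cmPointGaloisData hCM hGZK h11 hq hq3 hp hp5 hinj hQR hμ
  have hn : 2 * ∏ i, (vecCons q p : Fin (m + 1) → ℕ) i = 2 * (q * ∏ i, p i) := by rw [prod_star_cons]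
  obtain ⟨hr1, hrk, hsha, hiff⟩ :=
    rankOne_sha_bsdp_two_iff_congruentNumberCurve_two_mul_prod (vecCons q p : Fin (m + 1) → ℕ) hGZK hMe (star_cons_prime hq hp)
      (star_cons_injective hq3 hp5 hinj) hn (star_mod_eight hq3 hp hp5 hinj) (monskySelmerRankEven_star hq hq3 hp hp5 hQR hμ) hx0 hx
  exact ⟨hr1, hrk, hsha, hiff.mpr hv⟩

end ThetaDescent

end Summit.BirchSwinnertonDyer.Rank1Residual.P2

end
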